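import Summits.KontsevichZagierPeriods.KontsevichZagierPeriods.Theorems.OctahedralSymmetryOctahedralSpanAllWeightsStubRegularUnitFront
import Summits.KontsevichZagierPeriods.KontsevichZagierPeriods.Theorems.OctahedralSymmetryOctahedralSpanAllWeightsStubRegularUnitLayerOneCore
import Summits.KontsevichZagierPeriods.KontsevichZagierPeriods.Theorems.OctahedralSymmetryOctahedralSpanAllWeightsStubWeightTwo

/-!
# Crux `OctahedralSpanAllWeights` (stmt-KontsevichZagierPeriods-9659), line `Sketch`, block F2: the one-letter layer and the glue from the core

* `unitLayerOne` — for ALL lengths `n ≥ 3`, a unit word with exactly one letter other than `2`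
  (`2^a c 2^{n−1−a}`, `c = ±i`) reduces modulo `rel` to unit words of the same length with fewer letters `2`,
  using only the seed lifts `2^a c 2^{n−2−a} ш ([2]−[1]−[3])` (`toQ_shuffle_X_two`) and the involution
  relators of `c 2^{n−1}` and `2^{n−2} c̄ c̄` (`toQ_sigmaSubst_X/V`); elimination `layerOne_core`.
* `regular_unit_of_core` — block F2 (every unit word containing the pole `−1` reduces to unit words with
  fewer letters `2`) follows for ALL lengths from its residual CORE: the 2-INITIAL unit words with at least
  two letters other than `2`, given block F2 for shorter unit words (the stub `stub_regular_unit_core` of the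
  lead's skeleton; open in general, true for lengths `≤ 4` by exact rank). Ingredients: `unitFrontReduce`,
  `unitLayerTop` (file `…StubRegularUnitFront`), `unitLayerOne`, and the kernel-checked weight two
  `stub_weight_two` for the words `2c` of length `2`.
Sources: J. Zhao, Doc. Math. 15 (2010) §2, §5 [Zhao2010]; J. Zhao (2008) §4 [Zhao2008].
-/

noncomputable section

namespace Summit.KontsevichZagierPeriods.OctahedralSymmetry.OctaSpan.RegularUnit

open Literature.NumberTheory.Transcendental Literature.NumberTheory.Transcendental.LevelFour
open Summit.KontsevichZagierPeriods.FurushoPentagon.DoubleShuffleOfPentagon (perm_append_of_mem_shuffleWord)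

/-! ## Private tools -/

/-- Casting a term list to `WordQ` (local copy of the E2 tools). [folklore] -/
private theorem toQ_ofTerms (L : List (ℤ × List (Fin 5))) :
    toQ (ofTerms L) = (L.map fun p => (p.1 : ℚ) • sym p.2).sum := by
  induction L with
  | nil => simp
  | cons p L ih =>
    rw [ofTerms_cons, map_add, toQ_single, ih, List.map_cons, List.sum_cons, Int.cast_smul_eq_zsmul]

/-- The shuffle cast to `WordQ` is the plain sum over the interleavings (local copy). [folklore] -/
private theorem toQ_shuffle (u v : List (Fin 5)) :
    toQ (shuffle u v) = ((MZV.shuffleWord u v).map sym).sum := by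
  rw [shuffle, toQ_ofTerms, List.map_map]
  congr 1
  exact List.map_congr_left fun w _ => by simp

/-- `liftMap u [V] = u ш V` (local copy). [folklore] -/
private theorem liftMap_sym (u V : List (Fin 5)) : liftMap u (sym V) = toQ (shuffle u V) := by
  simp [liftMap, sym]

/-- `rel` is a shuffle ideal (local copy). [cite: Zhao2010, §2 Lemma 2.2] -/
private theorem liftMap_mem_rel {u : List (Fin 5)} (hu : IsConvergent u) {x : WordQ} (hx : x ∈ rel) :
    liftMap u x ∈ rel := by
  have h : Submodule.map (liftMap u) rel ≤ rel := by
    rw [rel, Submodule.map_span_le]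
    exact fun ρ hρ => mem_rel_of_isGen (IsGen.lift hu hρ)
  exact h (Submodule.mem_map_of_mem hx)

/-! ### The layer theorem: unit words with exactly one letter other than `2`, all lengths `≥ 3` -/

/-- A word which is a permutation of a unit word with `k` letters `2` lies in the lower span of length
`n` as soon as `k < n - 1` and the lengths match. [folklore] -/
theorem sym_mem_lowerUnit_of_perm {n : ℕ} {w u : List (Fin 5)} (hp : w.Perm u) (hlen : u.length = n)
    (hU : ∀ x ∈ u, x = 1 ∨ x = 2 ∨ x = 3) (hcount : u.count 2 < n - 1) :
    sym w ∈ Submodule.span ℚ (sym '' {V | V.length = n ∧ (∀ x ∈ V, x = 1 ∨ x = 2 ∨ x = 3) ∧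
      V.count 2 < n - 1}) :=
  Submodule.subset_span ⟨w, ⟨hp.length_eq.trans hlen, fun x hx => hU x (hp.subset hx),
    by rw [hp.count_eq]; exact hcount⟩, rfl⟩

/-- `2^a c 2^b` is a unit word when `c` is a unit letter. [folklore] -/
theorem isUnit_X {a b : ℕ} {c : Fin 5} (hc : c = 1 ∨ c = 3) :
    ∀ x ∈ List.replicate a (2 : Fin 5) ++ c :: List.replicate b 2, x = 1 ∨ x = 2 ∨ x = 3 := by
  intro x hx
  simp only [List.mem_append, List.mem_cons, List.mem_replicate] at hx
  rcases hx with ⟨-, rfl⟩ | rfl | ⟨-, rfl⟩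
  · exact Or.inr (Or.inl rfl)
  · exact hc.elim Or.inl fun h => Or.inr (Or.inr h)
  · exact Or.inr (Or.inl rfl)

/-- `#2 (2^a c 2^b) = a + b` for `c ≠ 2`. [folklore] -/
theorem count_two_X {a b : ℕ} {c : Fin 5} (hc : c ≠ 2) :
    (List.replicate a (2 : Fin 5) ++ c :: List.replicate b 2).count 2 = a + b := by
  rw [List.count_append, List.count_replicate_self, List.count_cons, List.count_replicate_self]
  simp [hc]

/-- **Block F2, the layer `#2 = n − 1` (all lengths `n ≥ 3`).** A unit word of length `n ≥ 3` with exactly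
one letter other than `2`, i.e. `2^a c 2^{n-1-a}` with `c = ±i`, reduces modulo `rel` to unit words of the
same length with fewer letters `2`. Internal generators only: the seed lifts `2^a c 2^{n-2-a} ш ([2]−[1]−[3])`
and the involution relators of `c 2^{n-1}` and of `2^{n-2} c̄ c̄`; the elimination is `layerOne_core`
(division by `n − 2` and by `n − 1 + (−1)^{n−1}`, so `n ≥ 3` is needed: for `n = 2` the words `2c`, `c2`
need a finite double shuffle). [cite: Zhao2008, §4] -/
theorem unitLayerOne (n : ℕ) (hn : 3 ≤ n) (a : ℕ) (ha : a ≤ n - 1) (c : Fin 5) (hc : c = 1 ∨ c = 3) :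
    sym (List.replicate a (2 : Fin 5) ++ c :: List.replicate (n - 1 - a) 2) ∈
      rel ⊔ Submodule.span ℚ (sym '' {V | V.length = n ∧ (∀ x ∈ V, x = 1 ∨ x = 2 ∨ x = 3) ∧
        V.count 2 < n - 1}) := by
  set T : Submodule ℚ WordQ := rel ⊔ Submodule.span ℚ (sym '' {V | V.length = n ∧
    (∀ x ∈ V, x = 1 ∨ x = 2 ∨ x = 3) ∧ V.count 2 < n - 1}) with hT
  -- the letters `±i` indexed by a Boolean, `ltr (!e)` is the conjugate of `ltr e`
  let ltr : Bool → Fin 5 := fun e => if e then 1 else 3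
  have hltr : ∀ e, ltr e = 1 ∨ ltr e = 3 := fun e => by cases e <;> simp [ltr]
  have hltr2 : ∀ e, ltr e ≠ 2 := fun e => by cases e <;> simp [ltr]
  have hpair : ∀ e, (ltr e = 1 ∧ ltr (!e) = 3) ∨ (ltr e = 3 ∧ ltr (!e) = 1) := fun e => by
    cases e <;> simp [ltr]
  let x : ℕ → Bool → WordQ ⧸ T := fun a e =>
    T.mkQ (sym (List.replicate a (2 : Fin 5) ++ ltr e :: List.replicate (n - 1 - a) 2))
  let z : WordQ ⧸ T := T.mkQ (sym (List.replicate n (2 : Fin 5)))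
  have hrelT : ∀ {y : WordQ}, y ∈ rel → T.mkQ y = 0 := fun hy =>
    (Submodule.Quotient.mk_eq_zero T).2 (Submodule.mem_sup_left hy)
  have hLT : ∀ {y : WordQ}, y ∈ Submodule.span ℚ (sym '' {V | V.length = n ∧
      (∀ x ∈ V, x = 1 ∨ x = 2 ∨ x = 3) ∧ V.count 2 < n - 1}) → T.mkQ y = 0 := fun hy =>
    (Submodule.Quotient.mk_eq_zero T).2 (Submodule.mem_sup_right hy)
  -- (s) the seed lifts
  have hs : ∀ (a : ℕ) (e : Bool), a + 1 ≤ n - 1 →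
      ((a + 1 : ℕ) : ℚ) • x (a + 1) e + ((n - 1 - a : ℕ) : ℚ) • x a e = 0 := by
    intro a e hale
    set u : List (Fin 5) := List.replicate a 2 ++ ltr e :: List.replicate (n - 2 - a) 2 with hu
    have huU : ∀ y ∈ u, y = 1 ∨ y = 2 ∨ y = 3 := isUnit_X (hltr e)
    have hulen : u.length = n - 1 := by simp [hu]; omega
    have hucount : u.count 2 = n - 2 := by rw [hu, count_two_X (hltr2 e)]; omega
    have hmem : liftMap u (dilGen [2]) ∈ rel :=
      liftMap_mem_rel (isConvergent_of_isUnitWord huU) (mem_rel_of_isGen (IsGen.dil (by decide) (by decide)))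
    rw [dilGen_two, map_sub, map_add, liftMap_sym, liftMap_sym, liftMap_sym, hu, toQ_shuffle_X_two,
      ← hu] at hmem
    have hside : ∀ d : Fin 5, (d = 1 ∨ d = 3) → T.mkQ (toQ (shuffle u [d])) = 0 := by
      intro d hd
      refine hLT ?_
      rw [toQ_shuffle]
      refine list_sum_mem fun y hy => ?_
      obtain ⟨w, hw, rfl⟩ := List.mem_map.1 hy
      refine sym_mem_lowerUnit_of_perm (perm_append_of_mem_shuffleWord _ _ hw) (by simp [hulen]; omega)
        (fun y hy => ?_) ?_
      · rcases List.mem_append.1 hy with h | h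
        · exact huU y h
        · rw [List.mem_singleton.1 h]; exact hd.elim Or.inl fun h' => Or.inr (Or.inr h')
      · have hd2 : d ≠ 2 := by rcases hd with rfl | rfl <;> decide
        rw [List.count_append, hucount, List.count_singleton', if_neg hd2]; omega
    have h0 := congrArg T.mkQ (show _ = liftMap u (dilGen [2]) from rfl)
    have := hrelT hmem
    rw [map_sub, map_add, map_add, map_smul, map_smul, hside 1 (Or.inl rfl), hside 3 (Or.inr rfl),
      add_zero, sub_zero] at this
    have e1 : n - 2 - a + 1 = n - 1 - a := by omega
    have e2 : n - 2 - a = n - 1 - (a + 1) := by omega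
    simp only [e1] at this
    rw [e2] at this
    exact this
  -- (i2) the involution of `2^{n-2} c̄ c̄`
  have hi2 : ∀ e : Bool, x 1 e + x 0 e = z := by
    intro e
    set V : List (Fin 5) := List.replicate (n - 2) 2 ++ [ltr (!e), ltr (!e)] with hV
    have hVU : ∀ y ∈ V, y = 1 ∨ y = 2 ∨ y = 3 := fun y hy => by
      rcases List.mem_append.1 hy with h | h
      · exact Or.inr (Or.inl (List.eq_of_mem_replicate h))
      · have : y = ltr (!e) := by simpa using h
        rw [this]; exact (hltr (!e)).elim Or.inl fun h' => Or.inr (Or.inr h')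
    have hmem : invGen V ∈ rel := mem_rel_of_isGen (IsGen.inv (isConvergent_of_isUnitWord hVU))
    have hbb : (ltr (!e) = 1 ∧ ltr e = 3) ∨ (ltr (!e) = 3 ∧ ltr e = 1) := by cases e <;> simp [ltr]
    rw [invGen, hV, toQ_sigmaSubst_V hbb hbb] at hmem
    have := hrelT hmem
    have hVL : T.mkQ (sym (List.replicate (n - 2) (2 : Fin 5) ++ [ltr (!e), ltr (!e)])) = 0 :=
      hLT (sym_mem_lowerUnit_of_perm (List.Perm.refl _) (by simp; omega) hVU (by
        rw [List.count_append, List.count_replicate_self, List.count_cons, List.count_singleton',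
          if_neg (hltr2 (!e))]
        simp [(hltr2 (!e))]; omega))
    have hWL : T.mkQ (sym (ltr e :: ltr e :: List.replicate (n - 2) (2 : Fin 5))) = 0 := by
      refine hLT (Submodule.subset_span ⟨_, ⟨by simp; omega, fun y hy => ?_, ?_⟩, rfl⟩)
      · simp only [List.mem_cons, List.mem_replicate] at hy
        rcases hy with rfl | rfl | ⟨-, rfl⟩
        · exact (hltr e).elim Or.inl fun h => Or.inr (Or.inr h)
        · exact (hltr e).elim Or.inl fun h => Or.inr (Or.inr h)
        · exact Or.inr (Or.inl rfl)
      · rw [List.count_cons, List.count_cons, List.count_replicate_self]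
        simp [hltr2 e]; omega
    rw [map_sub, map_add, map_sub, map_sub, hVL, hWL, zero_sub] at this
    -- identify the two middle words with `x 1 e`, `x 0 e`
    have e1 : (2 : Fin 5) :: ltr e :: List.replicate (n - 2) 2 =
        List.replicate 1 2 ++ ltr e :: List.replicate (n - 1 - 1) 2 := by
      rw [show n - 1 - 1 = n - 2 by omega]; simp [List.replicate_succ]
    have e2 : ltr e :: List.replicate (n - 2 + 1) (2 : Fin 5) =
        List.replicate 0 2 ++ ltr e :: List.replicate (n - 1 - 0) 2 := by
      simp; omega
    have e3 : List.replicate (n - 2 + 2) (2 : Fin 5) = List.replicate n 2 := by congr 1; omega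
    rw [e1, e2, e3] at this
    -- this : 0 - (0 - x1 - x0 + z) = 0
    simp only [x, z]
    rw [eq_comm, ← sub_eq_zero]
    calc _ = ((0 : WordQ ⧸ T) - T.mkQ (sym (List.replicate 1 2 ++ ltr e :: List.replicate (n - 1 - 1) 2))
          - T.mkQ (sym (List.replicate 0 2 ++ ltr e :: List.replicate (n - 1 - 0) 2))
          + T.mkQ (sym (List.replicate n (2 : Fin 5)))) := by abel
      _ = 0 := neg_eq_zero.1 this
  -- (i0) the involution of `c 2^{n-1}`
  have hi0 : ∀ e : Bool, x 0 e + x (n - 1) (!e) = z := by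
    intro e
    have hmem : invGen (List.replicate 0 (2 : Fin 5) ++ ltr e :: List.replicate (n - 1 - 0) 2) ∈ rel :=
      mem_rel_of_isGen (IsGen.inv (isConvergent_of_isUnitWord (isUnit_X (hltr e))))
    rw [invGen, toQ_sigmaSubst_X (hpair e)] at hmem
    have := hrelT hmem
    rw [map_sub, map_add, map_neg] at this
    have e1 : List.replicate (n - 1 - 0) (2 : Fin 5) ++ ltr (!e) :: List.replicate 0 2 =
        List.replicate (n - 1) 2 ++ ltr (!e) :: List.replicate (n - 1 - (n - 1)) 2 := by simp
    have e2 : List.replicate (0 + (n - 1 - 0) + 1) (2 : Fin 5) = List.replicate n 2 := by congr 1; omega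
    rw [e1, e2] at this
    simp only [x, z]
    rw [eq_comm, ← sub_eq_zero]
    calc _ = -(T.mkQ (sym (List.replicate 0 2 ++ ltr e :: List.replicate (n - 1 - 0) 2))
          - (-T.mkQ (sym (List.replicate (n - 1) 2 ++ ltr (!e) :: List.replicate (n - 1 - (n - 1)) 2))
            + T.mkQ (sym (List.replicate n (2 : Fin 5))))) := by abel
      _ = 0 := by rw [this, neg_zero]
  -- conclude
  obtain ⟨-, hx⟩ := layerOne_core n hn x z hs hi2 hi0
  have hce : c = ltr (decide (c = 1)) := by rcases hc with rfl | rfl <;> simp [ltr]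
  have := hx a (decide (c = 1)) ha
  simp only [x] at this
  rw [← hce] at this
  exact (Submodule.Quotient.mk_eq_zero T).1 this

/-! ### Glue: block F2 from its core (2-initial unit words with at least two letters other than `2`) -/

/-- A unit word with exactly one letter other than `2` is `2^a c 2^b` with `c = ±i`. [folklore] -/
theorem exists_X_of_count : ∀ (W : List (Fin 5)), (∀ a ∈ W, a = 1 ∨ a = 2 ∨ a = 3) →
    W.count 2 + 1 = W.length → ∃ (a b : ℕ) (c : Fin 5), (c = 1 ∨ c = 3) ∧
      W = List.replicate a 2 ++ c :: List.replicate b 2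
  | [], _, h => by simp at h
  | x :: W, hU, h => by
    have hUW : ∀ a ∈ W, a = 1 ∨ a = 2 ∨ a = 3 := fun a ha => hU a (List.mem_cons_of_mem x ha)
    by_cases hx : x = 2
    · subst hx
      have h' : W.count 2 + 1 = W.length := by
        simp only [List.count_cons_self, List.length_cons] at h; omega
      obtain ⟨a, b, c, hc, rfl⟩ := exists_X_of_count W hUW h'
      exact ⟨a + 1, b, c, hc, by simp [List.replicate_succ]⟩
    · have hc : x = 1 ∨ x = 3 := by
        rcases hU x (by simp) with h1 | h2 | h3
        · exact Or.inl h1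
        · exact absurd h2 hx
        · exact Or.inr h3
      have hW : W.count 2 = W.length := by
        rw [List.count_cons, if_neg (by simpa using hx), List.length_cons] at h; omega
      have hrep : W = List.replicate W.length 2 :=
        List.eq_replicate_iff.2 ⟨rfl, fun b hb => ((List.count_eq_length.1 hW) b hb).symm⟩
      exact ⟨0, W.length, x, hc, by rw [List.replicate_zero, List.nil_append, ← hrep]⟩

/-- Two-letter words of length `n` lie in the target span of block F2 of any unit word of length `n`
containing a letter `2`. [folklore] -/
theorem twoSpan_le_unitLower (W : List (Fin 5)) (h2 : 0 < W.count 2) :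
    twoSpan W.length ≤ Submodule.span ℚ (sym '' {V | V.length = W.length ∧
      (∀ a ∈ V, a = 1 ∨ a = 2 ∨ a = 3) ∧ V.count 2 < W.count 2}) := by
  refine Submodule.span_mono ?_
  rintro _ ⟨V, hV, rfl⟩
  obtain ⟨hlen, h13⟩ := (mem_twoWords_iff _ _).1 hV
  refine ⟨V, ⟨hlen, fun a ha => (h13 a ha).elim Or.inl fun h => Or.inr (Or.inr h), ?_⟩, rfl⟩
  have : V.count 2 = 0 :=
    List.count_eq_zero.2 fun h => by rcases h13 2 h with h' | h' <;> exact absurd h' (by decide)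
  omega

/-- **Block F2 from its core (all weights).** If every 2-INITIAL unit word with at least two letters
other than `2` reduces (given block F2 for all shorter unit words), then every unit word containing the
letter `2` reduces: strong induction on the length with the front reduction, the top layer `2^n`
(`unitLayerTop`), the layer `#2 = n − 1` (`unitLayerOne`, `n ≥ 3`) and the kernel-checked weight `2`
(`stub_weight_two`) for the two words `2c` of length `2`. [folklore] -/
theorem regular_unit_of_core
    (hcore : ∀ W : List (Fin 5),
      (∀ V : List (Fin 5), V.length < W.length → (∀ a ∈ V, a = 1 ∨ a = 2 ∨ a = 3) → 0 < V.count 2 →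
        sym V ∈ rel ⊔ Submodule.span ℚ (sym '' {V' | V'.length = V.length ∧
          (∀ a ∈ V', a = 1 ∨ a = 2 ∨ a = 3) ∧ V'.count 2 < V.count 2})) →
      (∀ a ∈ W, a = 1 ∨ a = 2 ∨ a = 3) → W.head? = some 2 → W.count 2 + 2 ≤ W.length →
      sym W ∈ rel ⊔ Submodule.span ℚ (sym '' {V | V.length = W.length ∧
        (∀ a ∈ V, a = 1 ∨ a = 2 ∨ a = 3) ∧ V.count 2 < W.count 2}))
    (W : List (Fin 5)) (hU : ∀ a ∈ W, a = 1 ∨ a = 2 ∨ a = 3) (h2 : 0 < W.count 2) :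
    sym W ∈ rel ⊔ Submodule.span ℚ (sym '' {V | V.length = W.length ∧
      (∀ a ∈ V, a = 1 ∨ a = 2 ∨ a = 3) ∧ V.count 2 < W.count 2}) := by
  suffices key : ∀ n (W : List (Fin 5)), W.length = n → (∀ a ∈ W, a = 1 ∨ a = 2 ∨ a = 3) →
      0 < W.count 2 → sym W ∈ rel ⊔ Submodule.span ℚ (sym '' {V | V.length = W.length ∧
        (∀ a ∈ V, a = 1 ∨ a = 2 ∨ a = 3) ∧ V.count 2 < W.count 2}) from key _ W rfl hU h2
  intro n
  induction n using Nat.strong_induction_on with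
  | _ n ihn =>
  intro W hn hU h2
  have IH : ∀ V : List (Fin 5), V.length < n → (∀ a ∈ V, a = 1 ∨ a = 2 ∨ a = 3) → 0 < V.count 2 →
      sym V ∈ rel ⊔ Submodule.span ℚ (sym '' {V' | V'.length = V.length ∧
        (∀ a ∈ V', a = 1 ∨ a = 2 ∨ a = 3) ∧ V'.count 2 < V.count 2}) :=
    fun V hV hVU hV2 => ihn V.length hV V rfl hVU hV2
  refine unitFrontReduce IH (fun W' hlen hhead hU' => ?_) W hn hU h2
  by_cases hk : W'.count 2 + 2 ≤ W'.length
  · exact hcore W' (fun V hV => IH V (hlen ▸ hV)) hU' hhead hk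
  have hle : W'.count 2 ≤ W'.length := List.count_le_length
  have hne : W' ≠ [] := fun h => by simp [h] at hhead
  have hpos : 0 < W'.length := List.length_pos_iff.2 hne
  rcases Nat.lt_or_ge (W'.count 2) W'.length with hlt | hge
  · -- exactly one letter other than `2`
    have hcnt : W'.count 2 + 1 = W'.length := by omega
    obtain ⟨a, b, c, hc, hW'⟩ := exists_X_of_count W' hU' hcnt
    have hc2 : c ≠ 2 := by rcases hc with rfl | rfl <;> decide
    rcases Nat.lt_or_ge W'.length 3 with hsmall | hbig
    · -- length 2: the word `2 c`; use the kernel-checked weight two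
      have ha : 0 < a := by
        rcases Nat.eq_zero_or_pos a with rfl | ha
        · rw [hW'] at hhead
          simp at hhead
          exact absurd hhead hc2
        · exact ha
      have hlen2 : W'.length = 2 := by
        have := congrArg List.length hW'
        simp at this; omega
      have h2' : 0 < W'.count 2 := by rw [hW', count_two_X hc2]; omega
      have hmem := stub_weight_two W' hlen2 (isConvergent_of_isUnitWord hU')
      rw [← hlen2] at hmem
      exact (sup_le_sup_left (twoSpan_le_unitLower W' h2') rel) hmem
    · -- length ≥ 3: the layer `#2 = n - 1`
      set N := W'.length with hN
      have hb : b = N - 1 - a := by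
        have := congrArg List.length hW'
        simp at this; omega
      have ha : a ≤ N - 1 := by
        have := congrArg List.length hW'
        simp at this; omega
      have h := unitLayerOne N hbig a ha c hc
      rw [← hb, ← hW'] at h
      have hcount : W'.count 2 = N - 1 := by omega
      rw [hcount]
      exact h
  · -- all letters are `2`
    have hall : W'.count 2 = W'.length := le_antisymm hle hge
    obtain ⟨m, hm⟩ : ∃ m, W'.length = m + 1 := ⟨W'.length - 1, by omega⟩
    have hrep : W' = List.replicate (m + 1) 2 := by
      rw [← hm]
      exact List.eq_replicate_iff.2 ⟨rfl, fun b hb => ((List.count_eq_length.1 hall) b hb).symm⟩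
    rw [hrep]
    exact unitLayerTop m

end Summit.KontsevichZagierPeriods.OctahedralSymmetry.OctaSpan.RegularUnit

end
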